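import Summits.ValiantsHypothesis.ValiantsHypothesis.Theorems.LacunarySymmetroidMatrixDescartesPivotArrowTwoKit
import Summits.ValiantsHypothesis.ValiantsHypothesis.Theorems.LacunarySymmetroidMatrixDescartesCensusPivotKit
import Summits.ValiantsHypothesis.ValiantsHypothesis.Theorems.LacunarySymmetroidMatrixDescartesPivotArrowFour

/-!
# `MatrixDescartes` (stmt-ValiantsHypothesis-18050) — THE `K = 2` PIVOT COLUMN AT INDEX ONE, ALL SIZES:
# `¬ PivotRootLawAt m 2 1 (2m − 1)` for EVERY `m` (the V-law count `2m` needs only ONE negative direction of `J`)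

HONEST FRAMING.  Cell `pub-symmetroid`, seat `val-sym-mdr-p2` (gen 8); helper file `--supports` the crux
`Theses.LacunarySymmetroid.MatrixDescartes` (OPEN), NO closure claim.  A LOWER-bound row for conjb-1's pivot currency
(`…CensusPivotDefs`): at format `(m, K) = (m, 2)` and pivot index ONE, `Z₊ ≥ 2m` for every `m` — the budget
`2(m−1)(K−1) + 2 = 2m` of the typed bilinear guess `RankOnePivotLawBilinear` at `K = 2` (the V-law's `2m` is attained with
index `m` by diagonal pencils; here with index one).  Companion of `…WLawArrowPivot` (`K = 3`: `4m − 2`) and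
`…PivotArrowFour` (`K = 4`: `6m − 4`).  Nothing here bears on `MatrixDescartes` in its window, on `stub_twoSided`,
`DoorA26` / `DoorA34`, the census registers, or `VP ≠ VNP`.

CONSTRUCTION (support `(e; below; above) = (3; 0; 5)`, size `k + 1`): BALANCED arrowhead letters
`P = [[diag(Ξᵢ⁷/Uᵢ), (Ξᵢ⁵)ᵢ], [·ᵀ, ∑UᵢΞᵢ³ + 1]]`, `Q = [[diag(Ξᵢ²/Uᵢ), (−1)ᵢ], [·ᵀ, ∑Uᵢ/Ξᵢ² + s]]`, `J = diag(Ξᵢ⁴/Uᵢ, …,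
−1 − ∑Uᵢ)`; `det(x³J + P + x⁵Q) = (∏mᵢ(x))·x³·(x⁻³ − 1 + ∑Uᵢφ₂(x/Ξᵢ) + s x²)` with the block shape
`φ₂(y) = y²(4 − y)/(1 + y³ + y⁵)` (`→ 0` at both ends, one excursion: `φ₂(1) = 1 > 1/2 > φ₂(5)`): two crossings per block,
two ends — the generic kit `…PivotArrowTwoKit` (`PivotArrowTwo.model_alternates`).

[folklore] Elementary; tree inputs `…PivotArrowTwoKit`, `WLawArrow.posSemidef_arrow`, `WLawArrow.det_arrow`,
`WLawArrow.prod_neg_of_alt`, `WLawArrow.le_card_posRoots_of_alternating_anti`, `Pivot.eval_det_pivot`.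
Axioms `propext`, `Classical.choice`, `Quot.sound`.
-/

set_option linter.dupNamespace false

namespace Summit.ValiantsHypothesis.ValiantsHypothesis.Theorems.LacunarySymmetroidMatrixDescartes

open scoped BigOperators Topology Matrix
open Filter Matrix Polynomial

namespace PivotArrowTwo

/-- The reference block shape `φ₂(y) = y²(4 − y)/(1 + y³ + y⁵)` (local notation, no definition). -/
local notation3 (prettyPrint := false) "φ₂[" y "]" =>
  ((y : ℝ) ^ 2 * (4 - (y : ℝ)) / (1 + (y : ℝ) ^ 3 + (y : ℝ) ^ 5))

/-- The scalar model `M₂(x) = x⁻³ − 1 + ∑ᵢ Uᵢ φ₂(x / Ξᵢ)` (local notation, no definition). -/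
local notation3 (prettyPrint := false) "M₂[" Ξ ", " U "](" x ")" =>
  ((x : ℝ)⁻¹ ^ 3 - 1 + ∑ i, (U : Fin _ → ℝ) i * φ₂[(x : ℝ) / (Ξ : Fin _ → ℝ) i])

/-- Letter `P` (exponent `0`; local notation, no definition). -/
local notation3 (prettyPrint := false) "Pblk[" Ξ ", " U "]" =>
  Matrix.fromBlocks (diagonal fun i => (Ξ : Fin _ → ℝ) i ^ 7 / (U : Fin _ → ℝ) i)
    (Matrix.of fun (i : Fin _) (_ : Fin 1) => (Ξ : Fin _ → ℝ) i ^ 5)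
    (Matrix.of fun (_ : Fin 1) (i : Fin _) => (Ξ : Fin _ → ℝ) i ^ 5)
    (Matrix.of fun (_ _ : Fin 1) => (∑ i, (U : Fin _ → ℝ) i * (Ξ : Fin _ → ℝ) i ^ 3) + 1)

/-- The pivot letter `J` (exponent `3`; diagonal; local notation, no definition). -/
local notation3 (prettyPrint := false) "J2[" Ξ ", " U "]" =>
  Matrix.fromBlocks (diagonal fun i => (Ξ : Fin _ → ℝ) i ^ 4 / (U : Fin _ → ℝ) i) 0 0
    (Matrix.of fun (_ _ : Fin 1) => -1 - ∑ i, (U : Fin _ → ℝ) i)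

/-- Letter `Q` (exponent `5`; carries the slack `s`; local notation, no definition). -/
local notation3 (prettyPrint := false) "Qblk[" Ξ ", " U ", " s "]" =>
  Matrix.fromBlocks (diagonal fun i => (Ξ : Fin _ → ℝ) i ^ 2 / (U : Fin _ → ℝ) i)
    (Matrix.of fun (_ : Fin _) (_ : Fin 1) => -(1 : ℝ))
    (Matrix.of fun (_ : Fin 1) (_ : Fin _) => -(1 : ℝ))
    (Matrix.of fun (_ _ : Fin 1) => (∑ i, (U : Fin _ → ℝ) i / (Ξ : Fin _ → ℝ) i ^ 2) + (s : ℝ))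

/-- Reindexing `Fin k ⊕ Fin 1 ≃ Fin (k + 1)` (local notation). -/
local notation3 (prettyPrint := false) "rx[" A "]" => Matrix.reindex finSumFinEquiv finSumFinEquiv A

/-- The two PSD letters as a `Fin 2`-family (local notation). -/
local notation3 (prettyPrint := false) "P2[" Ξ ", " U ", " s "]" =>
  (![rx[Pblk[Ξ, U]], rx[Qblk[Ξ, U, s]]] : Fin 2 → Matrix (Fin (_ + 1)) (Fin (_ + 1)) ℝ)

/-! ## The reference block shape -/

/-- `φ₂(5) < 1/2`. [folklore] -/
theorem phi_p1 : φ₂[(5 : ℝ)] < 1 / 2 := by norm_num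

/-- `φ₂(1) > 1/2`. [folklore] -/
theorem phi_p2 : (1 / 2 : ℝ) < φ₂[(1 : ℝ)] := by norm_num

/-- `φ₂(y) → 0` as `y → 0`. [folklore] -/
theorem tendsto_phi_zero : Tendsto (fun y : ℝ => φ₂[y]) (𝓝 0) (𝓝 0) := by
  have h : ContinuousAt (fun y : ℝ => φ₂[y]) 0 := by
    refine ContinuousAt.div ?_ ?_ ?_
    · fun_prop
    · fun_prop
    · norm_num
  simpa using h.tendsto

/-- `φ₂(y) → 0` as `y → ∞`. [folklore] -/
theorem tendsto_phi_atTop : Tendsto (fun y : ℝ => φ₂[y]) atTop (𝓝 0) := by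
  have hg : Tendsto (fun u : ℝ => (4 * u ^ 3 - u ^ 2) / (u ^ 5 + u ^ 2 + 1)) (𝓝 0) (𝓝 0) := by
    have hc : ContinuousAt (fun u : ℝ => (4 * u ^ 3 - u ^ 2) / (u ^ 5 + u ^ 2 + 1)) 0 := by
      refine ContinuousAt.div ?_ ?_ ?_
      · fun_prop
      · fun_prop
      · norm_num
    simpa using hc.tendsto
  refine (hg.comp tendsto_inv_atTop_zero).congr' ?_
  filter_upwards [eventually_gt_atTop (0 : ℝ)] with y hy
  have hy' : y ≠ 0 := hy.ne'
  have hd : (1 + y ^ 3 + y ^ 5) ≠ 0 := by positivity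
  simp only [Function.comp_apply]
  rw [div_eq_div_iff ?_ hd]
  · field_simp
  · have : 0 < y⁻¹ ^ 5 + y⁻¹ ^ 2 + 1 := by positivity
    exact this.ne'

/-! ## Block form and determinant -/

/-- The pencil `x³ J + (P + x⁵ Q)` in arrowhead form. [bookkeeping] -/
theorem pencil_arrow_eq {k : ℕ} (Ξ U : Fin k → ℝ) (s x : ℝ) :
    x ^ 3 • J2[Ξ, U] + (x ^ 0 • Pblk[Ξ, U] + x ^ 5 • Qblk[Ξ, U, s])
    = Matrix.fromBlocks
        (diagonal fun i => (Ξ i ^ 7 + Ξ i ^ 4 * x ^ 3 + Ξ i ^ 2 * x ^ 5) / U i)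
        (Matrix.of fun (i : Fin k) (_ : Fin 1) => Ξ i ^ 5 - x ^ 5)
        (Matrix.of fun (_ : Fin 1) (i : Fin k) => Ξ i ^ 5 - x ^ 5)
        (Matrix.of fun (_ _ : Fin 1) =>
          ((∑ i, U i * Ξ i ^ 3) + 1) + (-1 - ∑ i, U i) * x ^ 3 + ((∑ i, U i / Ξ i ^ 2) + s) * x ^ 5) := by
  ext i j
  rcases i with i | i <;> rcases j with j | j
  · by_cases hij : i = j
    · subst hij
      simp only [Matrix.add_apply, Matrix.smul_apply, Matrix.fromBlocks_apply₁₁, diagonal_apply_eq, smul_eq_mul]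
      ring
    · simp only [Matrix.add_apply, Matrix.smul_apply, Matrix.fromBlocks_apply₁₁, diagonal_apply_ne _ hij,
        smul_eq_mul, mul_zero, add_zero]
  · simp only [Matrix.add_apply, Matrix.smul_apply, Matrix.fromBlocks_apply₁₂, Matrix.of_apply,
      Matrix.zero_apply, smul_eq_mul]
    ring
  · simp only [Matrix.add_apply, Matrix.smul_apply, Matrix.fromBlocks_apply₂₁, Matrix.of_apply,
      Matrix.zero_apply, smul_eq_mul]
    ring
  · simp only [Matrix.add_apply, Matrix.smul_apply, Matrix.fromBlocks_apply₂₂, Matrix.of_apply, smul_eq_mul]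
    ring

/-- The diagonal entries are positive for `x ≥ 0`. [folklore] -/
theorem m_pos {Ξi Ui x : ℝ} (hΞ : 0 < Ξi) (hU : 0 < Ui) (hx : 0 ≤ x) :
    0 < (Ξi ^ 7 + Ξi ^ 4 * x ^ 3 + Ξi ^ 2 * x ^ 5) / Ui := by
  positivity

/-- **One balanced block**: its share of the Schur complement is `Uᵢ x³ φ₂(x/Ξᵢ)`. [folklore] -/
theorem block_identity {Ξi Ui x : ℝ} (hΞ : 0 < Ξi) (hU : 0 < Ui) (hx : 0 ≤ x) :
    Ui * Ξi ^ 3 - Ui * x ^ 3 + Ui / Ξi ^ 2 * x ^ 5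
        - (Ξi ^ 5 - x ^ 5) ^ 2 / ((Ξi ^ 7 + Ξi ^ 4 * x ^ 3 + Ξi ^ 2 * x ^ 5) / Ui)
      = Ui * x ^ 3 * φ₂[x / Ξi] := by
  have hD : 0 < Ξi ^ 5 + Ξi ^ 2 * x ^ 3 + x ^ 5 := by positivity
  have hden : 0 < 1 + (x / Ξi) ^ 3 + (x / Ξi) ^ 5 := by positivity
  have key : φ₂[x / Ξi] = x ^ 2 * Ξi ^ 2 * (4 * Ξi - x) / (Ξi ^ 5 + Ξi ^ 2 * x ^ 3 + x ^ 5) := by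
    rw [div_eq_div_iff hden.ne' hD.ne']
    field_simp
  have hm : (Ξi ^ 7 + Ξi ^ 4 * x ^ 3 + Ξi ^ 2 * x ^ 5) / Ui = Ξi ^ 2 * (Ξi ^ 5 + Ξi ^ 2 * x ^ 3 + x ^ 5) / Ui := by
    ring
  rw [key, hm]
  field_simp
  ring

/-- **The Schur complement of the balanced pencil is `x³ · (M₂ + s x²)`** (`x > 0`). [folklore] -/
theorem schur_eq {k : ℕ} (Ξ U : Fin k → ℝ) (hΞ : ∀ i, 0 < Ξ i) (hU : ∀ i, 0 < U i) (s : ℝ) {x : ℝ}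
    (hx : 0 < x) :
    (((∑ i, U i * Ξ i ^ 3) + 1) + (-1 - ∑ i, U i) * x ^ 3 + ((∑ i, U i / Ξ i ^ 2) + s) * x ^ 5)
        - ∑ i, (Ξ i ^ 5 - x ^ 5) ^ 2 / ((Ξ i ^ 7 + Ξ i ^ 4 * x ^ 3 + Ξ i ^ 2 * x ^ 5) / U i)
      = x ^ 3 * (M₂[Ξ, U](x) + s * x ^ 2) := by
  have hblocks : ∑ i, U i * φ₂[x / Ξ i] * x ^ 3
      = ∑ i, (U i * Ξ i ^ 3 - U i * x ^ 3 + U i / Ξ i ^ 2 * x ^ 5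
        - (Ξ i ^ 5 - x ^ 5) ^ 2 / ((Ξ i ^ 7 + Ξ i ^ 4 * x ^ 3 + Ξ i ^ 2 * x ^ 5) / U i)) := by
    refine Finset.sum_congr rfl fun i _ => ?_
    rw [block_identity (hΞ i) (hU i) hx.le]
    ring
  have hx3 : x⁻¹ ^ 3 * x ^ 3 = 1 := by
    rw [← mul_pow, inv_mul_cancel₀ hx.ne', one_pow]
  have hR : ∑ i, (U i * Ξ i ^ 3 - U i * x ^ 3 + U i / Ξ i ^ 2 * x ^ 5
        - (Ξ i ^ 5 - x ^ 5) ^ 2 / ((Ξ i ^ 7 + Ξ i ^ 4 * x ^ 3 + Ξ i ^ 2 * x ^ 5) / U i))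
      = (∑ i, U i * Ξ i ^ 3) - (∑ i, U i) * x ^ 3 + (∑ i, U i / Ξ i ^ 2) * x ^ 5
        - ∑ i, (Ξ i ^ 5 - x ^ 5) ^ 2 / ((Ξ i ^ 7 + Ξ i ^ 4 * x ^ 3 + Ξ i ^ 2 * x ^ 5) / U i) := by
    rw [Finset.sum_sub_distrib, Finset.sum_add_distrib, Finset.sum_sub_distrib, Finset.sum_mul, Finset.sum_mul]
  calc _ = (1 - x ^ 3 + s * x ^ 5) + ∑ i, (U i * Ξ i ^ 3 - U i * x ^ 3 + U i / Ξ i ^ 2 * x ^ 5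
        - (Ξ i ^ 5 - x ^ 5) ^ 2 / ((Ξ i ^ 7 + Ξ i ^ 4 * x ^ 3 + Ξ i ^ 2 * x ^ 5) / U i)) := by
          rw [hR]
          ring
    _ = (1 - x ^ 3 + s * x ^ 5) + ∑ i, U i * φ₂[x / Ξ i] * x ^ 3 := by rw [hblocks]
    _ = x ^ 3 * (M₂[Ξ, U](x) + s * x ^ 2) := by
          rw [← Finset.sum_mul]
          linear_combination (-1 : ℝ) * hx3

/-- The pencil of reindexed letters is the reindexed pencil. [bookkeeping] -/
theorem reindex_pencil {k : ℕ} (J A D : Matrix (Fin k ⊕ Fin 1) (Fin k ⊕ Fin 1) ℝ) (x : ℝ) :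
    x ^ 3 • rx[J] + (x ^ 0 • rx[A] + x ^ 5 • rx[D]) = rx[x ^ 3 • J + (x ^ 0 • A + x ^ 5 • D)] := by
  ext i j
  simp [Matrix.reindex_apply]

/-- `J` is symmetric. [bookkeeping] -/
theorem isSymm_J {k : ℕ} (Ξ U : Fin k → ℝ) : (rx[J2[Ξ, U]]).IsSymm := by
  rw [Matrix.reindex_apply]
  refine Matrix.IsSymm.submatrix ?_ _
  refine Matrix.IsSymm.fromBlocks (isSymm_diagonal _) (by simp) ?_
  ext i j; fin_cases i; fin_cases j; rfl

/-- **The pivot letter has index one**: `J + W Wᵀ ⪰ 0` for the column `W = (0, …, 0, √(1 + ∑Uᵢ))ᵀ`. [folklore] -/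
theorem indexOne_J {k : ℕ} (Ξ U : Fin k → ℝ) (hU : ∀ i, 0 < U i) :
    ∃ W : Matrix (Fin (k + 1)) (Fin 1) ℝ, (rx[J2[Ξ, U]] + W * Wᵀ).PosSemidef := by
  set c : ℝ := 1 + ∑ i, U i with hc
  have hc0 : 0 ≤ c := by
    rw [hc]
    have : 0 ≤ ∑ i, U i := Finset.sum_nonneg fun i _ => (hU i).le
    linarith
  set W₀ : Matrix (Fin k ⊕ Fin 1) (Fin 1) ℝ := Matrix.of (Sum.elim (fun _ _ => (0 : ℝ)) fun _ _ => Real.sqrt c)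
    with hW₀
  refine ⟨W₀.submatrix finSumFinEquiv.symm (Equiv.refl (Fin 1)), ?_⟩
  have hblock : J2[Ξ, U] + W₀ * W₀ᵀ
      = Matrix.fromBlocks (diagonal fun i => Ξ i ^ 4 / U i) 0 0 (0 : Matrix (Fin 1) (Fin 1) ℝ) := by
    ext i j
    rcases i with i | i <;> rcases j with j | j
    · simp [hW₀, Matrix.mul_apply, Matrix.fromBlocks]
    · simp [hW₀, Matrix.mul_apply, Matrix.fromBlocks]
    · simp [hW₀, Matrix.mul_apply, Matrix.fromBlocks]
    · simp only [hW₀, Matrix.add_apply, Matrix.fromBlocks_apply₂₂, Matrix.of_apply, Matrix.mul_apply,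
        Matrix.transpose_apply, Sum.elim_inr, Finset.sum_const, Finset.card_univ, Fintype.card_fin,
        nsmul_eq_mul, Nat.cast_one, one_mul, Matrix.zero_apply]
      rw [Real.mul_self_sqrt hc0, hc]
      ring
  have hrx : rx[J2[Ξ, U]] + W₀.submatrix finSumFinEquiv.symm (Equiv.refl (Fin 1))
        * (W₀.submatrix finSumFinEquiv.symm (Equiv.refl (Fin 1)))ᵀ
      = rx[J2[Ξ, U] + W₀ * W₀ᵀ] := by
    rw [Matrix.transpose_submatrix, Matrix.reindex_apply, Matrix.reindex_apply, Matrix.submatrix_add]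
    congr 1
  rw [hrx, hblock, Matrix.reindex_apply]
  refine Matrix.PosSemidef.submatrix ?_ _
  refine posSemidef_fromBlocks_zero (posSemidef_diagonal_iff.2 fun i => ?_) Matrix.PosSemidef.zero
  have := hU i
  positivity

/-- `P ⪰ 0` (Schur complement `1`). [folklore] -/
theorem posSemidef_P {k : ℕ} (Ξ U : Fin k → ℝ) (hΞ : ∀ i, 0 < Ξ i) (hU : ∀ i, 0 < U i) :
    (rx[Pblk[Ξ, U]]).PosSemidef := by
  rw [Matrix.reindex_apply]
  refine Matrix.PosSemidef.submatrix ?_ _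
  refine WLawArrow.posSemidef_arrow _ _ _ (fun i => by have := hΞ i; have := hU i; positivity) ?_
  have : ∑ i, (Ξ i ^ 5) ^ 2 / (Ξ i ^ 7 / U i) = ∑ i, U i * Ξ i ^ 3 := by
    refine Finset.sum_congr rfl fun i _ => ?_
    have h1 := (hΞ i).ne'
    have h2 := (hU i).ne'
    field_simp
  rw [this]
  linarith

/-- `Q ⪰ 0` (Schur complement `s ≥ 0`). [folklore] -/
theorem posSemidef_Q {k : ℕ} (Ξ U : Fin k → ℝ) (hΞ : ∀ i, 0 < Ξ i) (hU : ∀ i, 0 < U i) {s : ℝ} (hs : 0 ≤ s) :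
    (rx[Qblk[Ξ, U, s]]).PosSemidef := by
  rw [Matrix.reindex_apply]
  refine Matrix.PosSemidef.submatrix ?_ _
  refine WLawArrow.posSemidef_arrow _ (fun _ => -(1 : ℝ)) _ (fun i => by have := hΞ i; have := hU i; positivity) ?_
  have : ∑ i, (-(1 : ℝ)) ^ 2 / (Ξ i ^ 2 / U i) = ∑ i, U i / Ξ i ^ 2 := by
    refine Finset.sum_congr rfl fun i _ => ?_
    have h1 := (hΞ i).ne'
    have h2 := (hU i).ne'
    field_simp
  rw [this]
  linarith

/-- Both letters are positive semidefinite (as a `Fin 2`-family). [bookkeeping] -/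
theorem posSemidef_letters {k : ℕ} (Ξ U : Fin k → ℝ) (hΞ : ∀ i, 0 < Ξ i) (hU : ∀ i, 0 < U i) {s : ℝ}
    (hs : 0 ≤ s) : ∀ l : Fin 2, (P2[Ξ, U, s] l).PosSemidef := by
  intro l
  fin_cases l
  · simpa using posSemidef_P Ξ U hΞ hU
  · simpa using posSemidef_Q Ξ U hΞ hU hs

/-- **The determinant of the balanced pivot pencil at `x > 0`** is `(∏ᵢ mᵢ(x)) · x³ · (M₂(x) + s x²)`. [folklore] -/
theorem det_pencil_eval {k : ℕ} (Ξ U : Fin k → ℝ) (hΞ : ∀ i, 0 < Ξ i) (hU : ∀ i, 0 < U i) (s : ℝ)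
    {x : ℝ} (hx : 0 < x) :
    (Matrix.det (((X : ℝ[X]) ^ 3) • (rx[J2[Ξ, U]]).map Polynomial.C
        + ∑ l, ((X : ℝ[X]) ^ (![0, 5] : Fin 2 → ℕ) l) • (P2[Ξ, U, s] l).map Polynomial.C)).eval x
      = (∏ i, (Ξ i ^ 7 + Ξ i ^ 4 * x ^ 3 + Ξ i ^ 2 * x ^ 5) / U i) * (x ^ 3 * (M₂[Ξ, U](x) + s * x ^ 2)) := by
  rw [Pivot.eval_det_pivot]
  simp only [Fin.sum_univ_two, Matrix.cons_val_zero, Matrix.cons_val_one]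
  rw [reindex_pencil, Matrix.det_reindex_self, pencil_arrow_eq,
    WLawArrow.det_arrow _ _ _ (fun i => (m_pos (hΞ i) (hU i) hx.le).ne'), schur_eq Ξ U hΞ hU s hx]

/-- Opposite signs of `M₂ + s x²` at positive points give a negative product of determinant values. [bookkeeping] -/
theorem eval_mul_eval_neg {k : ℕ} (Ξ U : Fin k → ℝ) (hΞ : ∀ i, 0 < Ξ i) (hU : ∀ i, 0 < U i) (s : ℝ)
    {x y : ℝ} (hx : 0 < x) (hy : 0 < y)
    (hneg : (M₂[Ξ, U](x) + s * x ^ 2) * (M₂[Ξ, U](y) + s * y ^ 2) < 0) :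
    (Matrix.det (((X : ℝ[X]) ^ 3) • (rx[J2[Ξ, U]]).map Polynomial.C
        + ∑ l, ((X : ℝ[X]) ^ (![0, 5] : Fin 2 → ℕ) l) • (P2[Ξ, U, s] l).map Polynomial.C)).eval x
      * (Matrix.det (((X : ℝ[X]) ^ 3) • (rx[J2[Ξ, U]]).map Polynomial.C
        + ∑ l, ((X : ℝ[X]) ^ (![0, 5] : Fin 2 → ℕ) l) • (P2[Ξ, U, s] l).map Polynomial.C)).eval y < 0 := by
  rw [det_pencil_eval Ξ U hΞ hU s hx, det_pencil_eval Ξ U hΞ hU s hy]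
  have hc : 0 < (∏ i, (Ξ i ^ 7 + Ξ i ^ 4 * x ^ 3 + Ξ i ^ 2 * x ^ 5) / U i) * x ^ 3 :=
    mul_pos (Finset.prod_pos fun i _ => m_pos (hΞ i) (hU i) hx.le) (pow_pos hx 3)
  have hd : 0 < (∏ i, (Ξ i ^ 7 + Ξ i ^ 4 * y ^ 3 + Ξ i ^ 2 * y ^ 5) / U i) * y ^ 3 :=
    mul_pos (Finset.prod_pos fun i _ => m_pos (hΞ i) (hU i) hy.le) (pow_pos hy 3)
  set A := M₂[Ξ, U](x) + s * x ^ 2 with hA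
  set B := M₂[Ξ, U](y) + s * y ^ 2 with hB
  set c := (∏ i, (Ξ i ^ 7 + Ξ i ^ 4 * x ^ 3 + Ξ i ^ 2 * x ^ 5) / U i) with hcdef
  set d := (∏ i, (Ξ i ^ 7 + Ξ i ^ 4 * y ^ 3 + Ξ i ^ 2 * y ^ 5) / U i) with hddef
  have : c * (x ^ 3 * A) * (d * (y ^ 3 * B)) = (c * x ^ 3) * (d * y ^ 3) * (A * B) := by ring
  rw [this]
  exact mul_neg_of_pos_of_neg (mul_pos hc hd) hneg

/-! ## The end step and the theorems -/

/-- **The slack.**  Some `s > 0` keeps all the signs of `M₂ + s x²` at the listed points, and some point beyond the list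
has `M₂ + s x² > 0`. [folklore] -/
theorem end_step {k m : ℕ} (Ξ U : Fin k → ℝ) (hΞ : ∀ i, 0 < Ξ i)
    (σ : Fin (m + 1) → ℝ) (hsign : ∀ j : Fin (m + 1), 0 < (-1 : ℝ) ^ ((j : ℕ) + 1) * M₂[Ξ, U](σ j)) :
    ∃ s X : ℝ, 0 < s ∧ σ 0 < X ∧ 0 < M₂[Ξ, U](X) + s * X ^ 2 ∧
      ∀ j : Fin (m + 1), 0 < (-1 : ℝ) ^ ((j : ℕ) + 1) * (M₂[Ξ, U](σ j) + s * σ j ^ 2) := by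
  have E : ∀ j : Fin (m + 1), ∀ᶠ s : ℝ in 𝓝[>] 0,
      0 < (-1 : ℝ) ^ ((j : ℕ) + 1) * (M₂[Ξ, U](σ j) + s * σ j ^ 2) := by
    intro j
    have ht : Tendsto (fun s : ℝ => (-1 : ℝ) ^ ((j : ℕ) + 1) * (M₂[Ξ, U](σ j) + s * σ j ^ 2)) (𝓝[>] 0)
        (𝓝 ((-1 : ℝ) ^ ((j : ℕ) + 1) * (M₂[Ξ, U](σ j) + 0 * σ j ^ 2))) :=
      tendsto_nhdsWithin_of_tendsto_nhds (((tendsto_id.mul_const _).const_add _).const_mul _)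
    rw [zero_mul, add_zero] at ht
    exact ht.eventually_const_lt (hsign j)
  obtain ⟨s, hs, hsigns⟩ :=
    ((eventually_mem_nhdsWithin (a := (0 : ℝ)) (s := Set.Ioi 0)).and (eventually_all.2 E)).exists
  rw [Set.mem_Ioi] at hs
  have hM : Tendsto (fun x : ℝ => M₂[Ξ, U](x)) atTop (𝓝 (-1)) := by
    simpa only using PivotArrowSix.model_tendsto_atTop (fun y => φ₂[y]) tendsto_phi_atTop Ξ U hΞ
  have hT : Tendsto (fun x : ℝ => M₂[Ξ, U](x) + s * x ^ 2) atTop atTop :=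
    hM.add_atTop ((tendsto_pow_atTop (by norm_num : (2 : ℕ) ≠ 0)).const_mul_atTop hs)
  obtain ⟨X, hX1, hX2⟩ := ((hT.eventually_gt_atTop 0).and (eventually_gt_atTop (σ 0))).exists
  exact ⟨s, X, hs, hX2, hX1, hsigns⟩

/-- **BALANCED PIVOT PENCILS WITH TWO LETTERS, INDEX ONE, AND `2k + 2` POSITIVE ROOTS IN EVERY SIZE `k + 1`.**
[folklore] -/
theorem exists_pivotConfig_indexOne (k : ℕ) :
    ∃ (J : Matrix (Fin (k + 1)) (Fin (k + 1)) ℝ) (P : Fin 2 → Matrix (Fin (k + 1)) (Fin (k + 1)) ℝ)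
      (W : Matrix (Fin (k + 1)) (Fin 1) ℝ),
      J.IsSymm ∧ (∀ l, (P l).PosSemidef) ∧ (J + W * Wᵀ).PosSemidef ∧
      2 * k + 2 ≤ Pivot.pivotPosRoots 3 (![0, 5] : Fin 2 → ℕ) J P := by
  obtain ⟨Ξ, U, σ, hΞ, hU, hanti, hpos, hsign⟩ :=
    PivotArrowTwo.model_alternates (fun y => φ₂[y]) tendsto_phi_zero tendsto_phi_atTop
      (θ := 1 / 2) (p₁ := 5) (p₂ := 1) (by norm_num) (by norm_num) (by norm_num) phi_p1 phi_p2 k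
  have hsign' : ∀ j : Fin (2 * k + 1 + 1), 0 < (-1 : ℝ) ^ ((j : ℕ) + 1) * M₂[Ξ, U](σ j) := fun j => by
    simpa only using hsign j
  obtain ⟨s, Xr, hs, hX, hXval, hsigns⟩ := end_step Ξ U hΞ σ hsign'
  obtain ⟨W, hW⟩ := indexOne_J Ξ U hU
  refine ⟨rx[J2[Ξ, U]], P2[Ξ, U, s], W, isSymm_J Ξ U, posSemidef_letters Ξ U hΞ hU hs.le, hW, ?_⟩
  have hρpos : ∀ j, 0 < (vecCons Xr σ) j := by
    intro j
    refine Fin.cases ?_ (fun i => ?_) j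
    · simpa using (hpos 0).trans hX
    · simpa using hpos i
  unfold Pivot.pivotPosRoots
  refine WLawArrow.le_card_posRoots_of_alternating_anti _ (2 * k + 1 + 1) (vecCons Xr σ) (hanti.vecCons hX) hρpos
    fun j => ?_
  refine Fin.cases ?_ (fun i => ?_) j
  · have h0 := hsigns 0
    simp only [Fin.val_zero, zero_add, pow_one] at h0
    rw [Fin.castSucc_zero, Matrix.cons_val_zero, Fin.succ_zero_eq_one, Matrix.cons_val_one]
    exact eval_mul_eval_neg Ξ U hΞ hU s ((hpos 0).trans hX) (hpos 0) (mul_neg_of_pos_of_neg hXval (by linarith))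
  · rw [← Fin.succ_castSucc, Matrix.cons_val_succ, Matrix.cons_val_succ]
    exact eval_mul_eval_neg Ξ U hΞ hU s (hpos _) (hpos _)
      (WLawArrow.prod_neg_of_alt (fun x => M₂[Ξ, U](x) + s * x ^ 2) σ hsigns i)

end PivotArrowTwo

/-- **`Z₊ ≥ 2m` AT `(m, K) = (m, 2)`, INDEX ONE, EVERY `m`**: `¬ PivotRootLawAt m 2 1 (2m − 1)` for all `m ≥ 1`
(the V-law count `2m` with a single negative direction of the pivot letter). [folklore] -/
theorem not_pivotRootLawAt_two_one {m : ℕ} (hm : 1 ≤ m) : ¬ Pivot.PivotRootLawAt m 2 1 (2 * m - 1) := by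
  obtain ⟨k, rfl⟩ : ∃ k, m = k + 1 := ⟨m - 1, by omega⟩
  intro h
  obtain ⟨J, P, W, hJ, hP, hW, hA⟩ := PivotArrowTwo.exists_pivotConfig_indexOne k
  have h5 := h 3 ![0, 5] J P hJ hP ⟨W, hW⟩
  omega

/-- In law form: `PivotRootLawAt m 2 1 B → 2m ≤ B` (`m ≥ 1`). [bookkeeping] -/
theorem le_of_pivotRootLawAt_two_one {m B : ℕ} (hm : 1 ≤ m) (h : Pivot.PivotRootLawAt m 2 1 B) :
    2 * m ≤ B := by
  by_contra hB
  exact not_pivotRootLawAt_two_one hm (Pivot.pivotRootLawAt_mono h (by omega))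

/-- **The bilinear rank-one pivot law is SHARP along `K = 2` if it holds**: under `RankOnePivotLawBilinear` (typed, NOT
asserted), `PivotRootLawAt m 2 1 B ↔ 2m ≤ B` for every `m ≥ 1`. [bookkeeping] -/
theorem pivotRootLawAt_two_one_iff_of_bilinear (hbil : Pivot.RankOnePivotLawBilinear) {m B : ℕ} (hm : 1 ≤ m) :
    Pivot.PivotRootLawAt m 2 1 B ↔ 2 * m ≤ B := by
  refine ⟨le_of_pivotRootLawAt_two_one hm, fun hB => ?_⟩
  have h := hbil m 2
  refine Pivot.pivotRootLawAt_mono h ?_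
  omega

/-- **Summary — the index-one pivot columns `K = 2, 3, 4` at every size**: unconditionally `Z₊` reaches
`2m`, `4m − 2`, `6m − 4` (`= 2(m−1)(K−1) + 2`), and under the typed bilinear guess these are the exact rows.
[bookkeeping] -/
theorem indexOne_columns_sharp_of_bilinear (hbil : Pivot.RankOnePivotLawBilinear) {m : ℕ} (hm : 1 ≤ m) :
    (∀ B, Pivot.PivotRootLawAt m 2 1 B ↔ 2 * m ≤ B) ∧ (∀ B, Pivot.PivotRootLawAt m 3 1 B ↔ 4 * m - 2 ≤ B) ∧
      (∀ B, Pivot.PivotRootLawAt m 4 1 B ↔ 6 * m - 4 ≤ B) :=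
  ⟨fun _ => pivotRootLawAt_two_one_iff_of_bilinear hbil hm, fun _ => pivotRootLawAt_three_one_iff_of_bilinear hbil hm,
    fun _ => pivotRootLawAt_four_one_iff_of_bilinear hbil hm⟩

end Summit.ValiantsHypothesis.ValiantsHypothesis.Theorems.LacunarySymmetroidMatrixDescartes
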